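import Summits.ValiantsHypothesis.ValiantsHypothesis.Theorems.KPlusLogSqLawTropicalShiftSquareChain

/-!
# Route «KPlusLogSqLaw» — the explicit `K = a + 3` tropical family DIAMOND: definitions

HONEST FRAMING.  Definitions-only file (D-0009) of the helper chain `--supports` the crux
`Summit.ValiantsHypothesis.ValiantsHypothesis.Theses.KPlusLogSqLaw.TropicalB` (ledger item `stmt-ValiantsHypothesis-19771`, route `KPlusLogSqLaw`;
object-search cell `pub-symmetroid`, seat val-sym-trop-p5 g8, 2026-08-27).  Nothing here asserts `TropicalB`, `WeakLifting`, `KPlusLogSqLaw`,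
`MatrixDescartes` or anything about `VP ≠ VNP`; the family is quadratic in `m` (leading constant `K − 3`), far inside every open question of the
cell (the `K = 4` fork, the window of `TropicalB`).
It names ONE explicit tropical design per format `(m, a+3)`, `m = n + 1 ≥ 1`, `a ≥ 0`, in the tree's dominance vocabulary, the grid of its
intended optima and the bookkeeping of the proof; nothing is proved here (the companion files `…TropicalShiftDiamond.lean`,
`…TropicalShiftDiamondDomination.lean`, `…TropicalShiftDiamondChain.lean` prove that the design has `a·m² + 2m + 1` sign-alternating unique
optima, whence **`TropicalCensus.TropRootLawAt m (a+3) B → a·m² + 2m ≤ B`, i.e. `T(m,K) ≥ (K−3)·m² + 2m` for every `m ≥ 1`, `K ≥ 3`**).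
These are concrete witnesses, not notions: no statement of the route depends on them.

THE DESIGN (the rotation/era skeleton of SHIFT-SQUARE / SHIFT-GRID with the optimal rung profile).  Classes `l < a + 3`: `l = 0` is the class
`(h, j) = (0, 0)`, `1 ≤ l ≤ a + 1` are `(1, l − 1)`, `l = a + 2` is `(2, 0)` (`hi`, `lo`); exponents `d l = lo l + hi l · D`, the DIAMOND
`{0} ∪ {D, D+1, …, D+a} ∪ {2D}` — all `a` low rungs sit on the MIDDLE high level.  FULL SUPPORT (`ee`): every entry carries every class, signed
`(−1)^{lo l}`, except that the LAST COLUMN carries in addition a phase sign `tau` (below).  EFFECTIVE SHIFT (`eshift`) = `shift + (hi − [wrap])·m`,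
so the phases are `P = 0 … 2m`: era 0 (`P < m`) uses the rotation by `P` with its `P` wrapping (upper-triangle) entries at `h = 1` — these CLIMB
their `a` rungs — and the others at `h = 0`; era 1 (`m ≤ P < 2m`) uses the rotation by `P − m` with the non-wrapping (lower-triangle and
diagonal) entries at `h = 1` — now THESE climb — and the wrapping ones at `h = 2`; era 2 (`P = 2m`) is the identity at `h = 2`.  So phase `P` has
`climb P` climbing columns (`P`, resp. `2m − P`) and `a·climb P + 1` grid points; the rungs are climbed round-robin over the climbing columns
(`lvl c s ps = s div c + [ps < s mod c]`; the `i`-th rung of the climbing column at position `ps` is priced `2W·P + 2((i−1)c + ps + 1)`,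
cumulative price `priceSum`), where the companion count `cnt` and the position `pos` of a climbing entry are read off the entry itself
(upper entry: `cnt = shift`, `pos = row`; lower entry: `cnt = m − shift`, `pos = column`).  Valuations (`vv`): `pen(effective shift) + priceSum`
with `pen q = κ·W·q(q+1)`, `W = a·m + 1`, `κ = 2aW + 2a + 1`, `D = m·κ`.  Grid: `(P, s)` with slope `θ(P,s) = 2W·P + 2s + 1`; since the phases
have different lengths, the cumulative index `st P = Σ_{P' < P} (a·climb P' + 1)` enters the signs: the last-column incidence of phase `P`
(identified by `desig`) carries `tau P = (−1)^{st P + n·(P mod m)}`, which makes the `k`-th grid term have sign `(−1)^k` (SHIFT-THREE's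
phase-sign device).  `hcol`, `pcol`, `jcol`, `cls`, `lam`, `cterm` describe the grid term, `phi` the gauged per-incidence score, `gval`, `bonus`,
`step`/`grid` the enumeration.  Every entry spends its `a` raises exactly once (upper entries in era 0, lower ones in era 1): the count
`a·m² + 2m + 1` is the sumset ceiling `Σ_H (a·min(H, 2m−H) + 1)` of the diamond type, and `K − 3` is the best leading constant of any stack
profile `(A_0, …, A_E)` under this mechanism (`m²(Σ_h A_h − (A_0 + A_E)/2)`).
-/

set_option linter.dupNamespace false
set_option autoImplicit false

namespace Summit.ValiantsHypothesis.ValiantsHypothesis.Theorems.LacunarySymmetroidMatrixDescartes.TropicalCensus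

open Summit.ValiantsHypothesis.ValiantsHypothesis.Theorems.MatrixDescartes.Negative
open scoped BigOperators
open Finset

namespace ShiftDiamond

open ShiftThree (shiftZ)
open ShiftSquare (rot)

variable (a n : ℕ)

/-- the maximal phase width `W = a·m + 1`. -/
def width : ℕ := a * (n + 1) + 1

/-- the gauge slope `κ = 2aW + 2a + 1` per unit of effective shift. -/
def kap : ℕ := 2 * a * width a n + 2 * a + 1

/-- the large exponent `D = m·κ` of one unit of the high digit. -/
def bigD : ℕ := (n + 1) * kap a n

/-- the high digit of a class: `0` for the class `0`, `2` for the class `a + 2`, `1` for the `a + 1` middle classes. -/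
def hi (l : Fin (a + 3)) : ℕ := if (l : ℕ) = 0 then 0 else if (l : ℕ) = a + 2 then 2 else 1

/-- the low rung of a class: `l − 1` on the middle classes, `0` on the two extreme ones. -/
def lo (l : Fin (a + 3)) : ℕ := if (l : ℕ) = 0 then 0 else if (l : ℕ) = a + 2 then 0 else (l : ℕ) - 1

/-- exponents: the DIAMOND `{0} ∪ {D, D+1, …, D+a} ∪ {2D}`, `d l = lo l + hi l · D`. -/
def dd (l : Fin (a + 3)) : ℕ := lo a l + hi a l * bigD a n

/-- EFFECTIVE SHIFT of an incidence: `shift + (high digit − [wrap])·m`. -/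
def eshift (r b : Fin (n + 1)) (l : Fin (a + 3)) : ℤ :=
  shiftZ n r b + ((hi a l : ℤ) - (if (r : ℕ) < (b : ℕ) then 1 else 0)) * ((n : ℤ) + 1)

/-- number of CLIMBING columns of the phase in which the entry `(r, b)` climbs: its shift for an upper entry (era 0), `m −` shift
for a lower or diagonal entry (era 1). -/
def cnt (r b : Fin (n + 1)) : ℤ := if (r : ℕ) < (b : ℕ) then shiftZ n r b else ((n : ℤ) + 1) - shiftZ n r b

/-- position of the entry `(r, b)` among the climbing columns of its phase: the row for an upper entry, the column otherwise. -/
def pos (r b : Fin (n + 1)) : ℤ := if (r : ℕ) < (b : ℕ) then (r : ℤ) else (b : ℤ)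

/-- shift penalty `pen q = κ·W·q(q+1)`. -/
def pen (q : ℤ) : ℤ := (kap a n : ℤ) * (width a n : ℤ) * (q * (q + 1))

/-- cumulative price of the first `j` rungs of a climbing entry with effective shift `q`, in a phase with `c` climbing columns, at
position `ps`: `Σ_{i ≤ j} (2W·q + 2((i−1)c + ps + 1)) = j(2Wq + 2(ps+1)) + c·j(j−1)` (rungs are climbed round-robin over the climbing columns). -/
def priceSum (q c ps : ℤ) (j : ℕ) : ℤ := (j : ℤ) * (2 * (width a n : ℤ) * q + 2 * (ps + 1)) + c * j * ((j : ℤ) - 1)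

/-- valuations: penalty of the effective shift plus the cumulative price of the low rungs. -/
def vv : Fin (n + 1) → Fin (n + 1) → Fin (a + 3) → ℤ := fun r b l =>
  pen a n (eshift a n r b l) + priceSum a n (eshift a n r b l) (cnt n r b) (pos n r b) (lo a l)

/-- number of climbing columns of phase `P`: `P` in era 0 (`P ≤ n`), `2m − P` in era 1 (`m ≤ P ≤ 2m`). -/
def climb (P : ℕ) : ℕ := if P ≤ n then P else 2 * (n + 1) - P

/-- index of the first term of phase `P`: `st P = Σ_{P' < P} (a·climb P' + 1)`. -/
def st : ℕ → ℕ
  | 0 => 0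
  | P + 1 => st P + (a * climb n P + 1)

/-- the phase sign gadget: `(−1)^{st P + n·(P mod m)}`, carried by ONE private incidence of phase `P` (column `n`). -/
def tau (P : ℕ) : ℤ := (-1) ^ (st a n P + n * (P % (n + 1)))

/-- the phase served by a column-`n` incidence: era `hi − [wrap]`, rotation = its shift (`r + 1` for an upper entry, `0` on the diagonal). -/
def desig (r : Fin (n + 1)) (l : Fin (a + 3)) : ℕ :=
  (hi a l - (if (r : ℕ) < n then 1 else 0)) * (n + 1) + (if (r : ℕ) < n then (r : ℕ) + 1 else 0)

/-- presence/sign pattern: FULL support; sign `(−1)^{lo l}`, times the phase gadget on the last column. -/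
def ee : Fin (n + 1) → Fin (n + 1) → Fin (a + 3) → ℤ := fun r b l =>
  (-1) ^ lo a l * (if (b : ℕ) = n then tau a n (desig a n r l) else 1)

/-- slope grid: `θ(P,s) = 2W·P + 2s + 1`. -/
def th (P s : ℕ) : ℤ := 2 * (width a n : ℤ) * P + 2 * s + 1

/-- round-robin rung level at step `s` of the climbing column at position `ps` among `c`: `s div c + [ps < s mod c]`. -/
def lvl (c s ps : ℕ) : ℕ := s / c + (if ps < s % c then 1 else 0)

/-- high digit of column `b` in phase `P`: era `P div m` plus one on the wrapping columns of the rotation `P mod m`. -/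
def hcol (P : ℕ) (b : Fin (n + 1)) : ℕ := P / (n + 1) + (if n + 1 ≤ (b : ℕ) + P % (n + 1) then 1 else 0)

/-- position of column `b` among the climbing columns of phase `P` (era 0: `b + r − m`; era 1: `b`). -/
def pcol (P : ℕ) (b : Fin (n + 1)) : ℕ := if P ≤ n then (b : ℕ) + P - (n + 1) else (b : ℕ)

/-- low rung of column `b` at step `s` of phase `P`: the round-robin level if the column climbs (high digit `1`), else `0`; capped at `a`. -/
def jcol (P s : ℕ) (b : Fin (n + 1)) : ℕ := if hcol n P b = 1 then min a (lvl (climb n P) s (pcol n P b)) else 0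

/-- the class with digits `(h, j)`: `0`, `j + 1`, `a + 2` for `h = 0, 1, ≥ 2`. -/
def cls (h j : ℕ) (hj : j ≤ a) : Fin (a + 3) :=
  ⟨if h = 0 then 0 else if h = 1 then j + 1 else a + 2, by split_ifs <;> omega⟩

/-- the class map of the grid point `(P, s)`. -/
def lam (P s : ℕ) : Fin (n + 1) → Fin (a + 3) := fun b =>
  cls a (hcol n P b) (jcol a n P s b) (by unfold jcol; split_ifs <;> [exact min_le_left _ _; exact Nat.zero_le _])

/-- the Leibniz term of the grid point `(P, s)`: rotation by `P mod m`, classes `lam P s`. -/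
def cterm (P s : ℕ) : Equiv.Perm (Fin (n + 1)) × (Fin (n + 1) → Fin (a + 3)) := (rot n (P % (n + 1)), lam a n P s)

/-- per-incidence score in the zero-sum gauge `θ·κ·shift − θ·D·[wrap]`. -/
def phi (θ : ℤ) (r b : Fin (n + 1)) (l : Fin (a + 3)) : ℤ :=
  θ * (dd a n l : ℤ) - vv a n r b l + θ * (kap a n : ℤ) * shiftZ n r b -
    θ * (bigD a n : ℤ) * (if (r : ℕ) < (b : ℕ) then 1 else 0)

/-- shift part of the score: `g_θ(q) = θκq − pen q`. -/
def gval (θ q : ℤ) : ℤ := θ * (kap a n : ℤ) * q - pen a n q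

/-- the rung bonus `j·θ − priceSum`. -/
def bonus (θ q c ps : ℤ) (j : ℕ) : ℤ := (j : ℤ) * θ - priceSum a n q c ps j

/-- successor on the grid: `(P, s) ↦ (P, s+1)` inside the phase, else `(P+1, 0)`. -/
def step (x : ℕ × ℕ) : ℕ × ℕ := if x.2 < a * climb n x.1 then (x.1, x.2 + 1) else (x.1 + 1, 0)

/-- the `k`-th grid point. -/
def grid (k : ℕ) : ℕ × ℕ := (step a n)^[k] (0, 0)

end ShiftDiamond

end Summit.ValiantsHypothesis.ValiantsHypothesis.Theorems.LacunarySymmetroidMatrixDescartes.TropicalCensus
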